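import Mathlib
import HarnessLib
import Summits.HubbardSuperconductivity.HubbardSuperconductivity.Theorems.KLProgrammePerturbedFermiCurveFrameHessBridge

/-!
# Route `KLProgramme` — ENGINE child (stmt-HubbardSuperconductivity-20437 `KLRegimeEngineV17F2`): the SLOPE–NORMAL-ANGLE identity on the perturbed Fermi curve
# — «crossing slope = radial derivative × speed × sin(normal-angle difference)» — core of the transversality alternative (T1) of the
# `TwoShellFrameAreaAt` witness (design note HOME/hubbard-kl-k3c2-p2/TWO-SHELL-FRAME-PORT.md §3)

Cell `gate-hubbard-kl`, seat hubbard-kl-k3c2-p2 g15.  For a root selection `u` of the perturbed curve `{ε₀ + δ = ν}` (p4's C⁰/C¹ binders) write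
`α(φ) = φ − arctan(u′/u)` (normal angle), `S = u² + u′²`, `ρ_r(φ) = ∂_tF(φ,u) + Dδ(p)[dir φ]` (radial derivative of `E = ε₀ + δ`, `≥ Dt_min − κ₁ > 0`), and
`ℓ_p(v) := 2 sin X_E·v₀ + 2 sin Y_E·v₁ + Dδ(p)[v] = DE(p)[v]` (= `De_K(toLp p)[toLp v]`, `fderiv_frameLevel_toLp`).  Then:
* §1 `sqrt_sq_add_sq_mul_cos/sin_normalAngle`, **`VXE_eq_neg_sqrt_mul_sin` / `VYE_eq_sqrt_mul_cos`** — the tangent is `√S·dir(α + π/2)`: `X_E′ = −√S sin α`,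
  `Y_E′ = √S cos α` (`cos(arctan x) = 1/√(1+x²)`);
* §2 **`slopeForm_eq_radial_mul`** — the GRADIENT NORMAL FORM: for every `v`, `ℓ_p(v) = (ρ_r·√S/u)·(cos α·v₀ + sin α·v₁)` (tangency `ℓ_p(p′) = 0` =
  p4's `levelIdentity_one`, radial value `ℓ_p(dir φ) = ρ_r` = `two_mul_sin_dir_eq_rayDispersionDt`);
* §3 **`slopeForm_tangent_eq_sin`** — for a SECOND radius function `u₂` (any level) with normal angle `α₂` and tangent `v₂ = (X₂′, Y₂′)` at `θ`:
  `ℓ_{p₁(φ)}(v₂(θ)) = (ρ_r(φ)·√S₁/u₁)·√S₂·sin(α₁(φ) − α₂(θ))`, and **`abs_slopeForm_tangent_ge`**: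
  `(Dt_min − κ₁)·u_min·|sin(α₁(φ) − α₂(θ))| ≤ |ℓ_{p₁(φ)}(v₂(θ))|` — a small crossing slope forces (nearly) PARALLEL normals, whence (by
  `…GaussMapHalfTorus`) equal or antipodal angles: the Cooper / caustic alternative.
Everything is PROVED; no definitions, no named facts; nothing asserts any stub or superconductivity.
References: BGM 2003 §7.1 (A1.9)–(A1.10) [cite: BenfattoGiulianiMastropietro2003]; FST II App. B [cite: FeldmanSalmhoferTrubowitz1998].
-/

noncomputable section

namespace Summit.HubbardSuperconductivity.HubbardSuperconductivity.Theorems.PerturbedFermiCurve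

set_option linter.dupNamespace false -- summit = problem name (single-conjunct summit), D-0017

open Real Set
open Literature.MathematicalPhysics.QuantumLattice Literature.MathematicalPhysics.QuantumLattice.BandSectorCounting

/-! ## §1 The tangent in terms of the normal angle -/

/-- `√(u² + p²)·cos(θ − arctan(p/u)) = u cos θ + p sin θ` for `u > 0`. [folklore] -/
theorem sqrt_mul_cos_sub_arctan {u p : ℝ} (hu : 0 < u) (θ : ℝ) :
    Real.sqrt (u ^ 2 + p ^ 2) * Real.cos (θ - Real.arctan (p / u)) = u * Real.cos θ + p * Real.sin θ := by
  have hq : 0 < Real.sqrt (1 + (p / u) ^ 2) := Real.sqrt_pos.2 (by positivity)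
  have hx : Real.sqrt (u ^ 2 + p ^ 2) = u * Real.sqrt (1 + (p / u) ^ 2) := by
    rw [← Real.sqrt_sq hu.le, ← Real.sqrt_mul (sq_nonneg u), Real.sqrt_sq hu.le]
    congr 1; field_simp
  have h1 : Real.sqrt (1 + (p / u) ^ 2) * (1 / Real.sqrt (1 + (p / u) ^ 2)) = 1 := by field_simp
  have h2 : u * (Real.sqrt (1 + (p / u) ^ 2) * (p / u / Real.sqrt (1 + (p / u) ^ 2))) = p := by field_simp
  rw [hx, Real.cos_sub, Real.cos_arctan, Real.sin_arctan]
  linear_combination (u * Real.cos θ) * h1 + Real.sin θ * h2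

/-- `√(u² + p²)·sin(θ − arctan(p/u)) = u sin θ − p cos θ` for `u > 0`. [folklore] -/
theorem sqrt_mul_sin_sub_arctan {u p : ℝ} (hu : 0 < u) (θ : ℝ) :
    Real.sqrt (u ^ 2 + p ^ 2) * Real.sin (θ - Real.arctan (p / u)) = u * Real.sin θ - p * Real.cos θ := by
  have hq : 0 < Real.sqrt (1 + (p / u) ^ 2) := Real.sqrt_pos.2 (by positivity)
  have hx : Real.sqrt (u ^ 2 + p ^ 2) = u * Real.sqrt (1 + (p / u) ^ 2) := by
    rw [← Real.sqrt_sq hu.le, ← Real.sqrt_mul (sq_nonneg u), Real.sqrt_sq hu.le]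
    congr 1; field_simp
  have h1 : Real.sqrt (1 + (p / u) ^ 2) * (1 / Real.sqrt (1 + (p / u) ^ 2)) = 1 := by field_simp
  have h2 : u * (Real.sqrt (1 + (p / u) ^ 2) * (p / u / Real.sqrt (1 + (p / u) ^ 2))) = p := by field_simp
  rw [hx, Real.sin_sub, Real.cos_arctan, Real.sin_arctan]
  linear_combination (u * Real.sin θ) * h1 - Real.cos θ * h2

/-- **`X_E′ = −√(u² + u′²)·sin α`** with `α = θ − arctan(u′/u)` (`u > 0`). [cite: BenfattoGiulianiMastropietro2003, §7.1 (A1.10)] -/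
theorem VXE_eq_neg_sqrt_mul_sin {u : ℝ → ℝ} {θ : ℝ} (hu : 0 < u θ) :
    VXE u θ = -(Real.sqrt (u θ ^ 2 + deriv u θ ^ 2) * Real.sin (θ - Real.arctan (deriv u θ / u θ))) := by
  rw [sqrt_mul_sin_sub_arctan hu, VXE]; ring

/-- **`Y_E′ = √(u² + u′²)·cos α`** with `α = θ − arctan(u′/u)` (`u > 0`). [cite: BenfattoGiulianiMastropietro2003, §7.1 (A1.10)] -/
theorem VYE_eq_sqrt_mul_cos {u : ℝ → ℝ} {θ : ℝ} (hu : 0 < u θ) :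
    VYE u θ = Real.sqrt (u θ ^ 2 + deriv u θ ^ 2) * Real.cos (θ - Real.arctan (deriv u θ / u θ)) := by
  rw [sqrt_mul_cos_sub_arctan hu, VYE]; ring

/-- `cos φ = (u cos α − u′ sin α)/√S` in the form `√S·(cos α·cos φ + sin α·sin φ) = u` (the angle between normal and ray is `arctan(u′/u)`). [folklore] -/
theorem sqrt_mul_cos_normalAngle_sub {u : ℝ → ℝ} {φ : ℝ} (hu : 0 < u φ) :
    Real.sqrt (u φ ^ 2 + deriv u φ ^ 2) *
        (Real.cos (φ - Real.arctan (deriv u φ / u φ)) * Real.cos φ + Real.sin (φ - Real.arctan (deriv u φ / u φ)) * Real.sin φ) = u φ := by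
  have h1 := sqrt_mul_cos_sub_arctan (p := deriv u φ) hu φ
  have h2 := sqrt_mul_sin_sub_arctan (p := deriv u φ) hu φ
  have e : Real.sqrt (u φ ^ 2 + deriv u φ ^ 2) *
        (Real.cos (φ - Real.arctan (deriv u φ / u φ)) * Real.cos φ + Real.sin (φ - Real.arctan (deriv u φ / u φ)) * Real.sin φ) =
      (Real.sqrt (u φ ^ 2 + deriv u φ ^ 2) * Real.cos (φ - Real.arctan (deriv u φ / u φ))) * Real.cos φ +
        (Real.sqrt (u φ ^ 2 + deriv u φ ^ 2) * Real.sin (φ - Real.arctan (deriv u φ / u φ))) * Real.sin φ := by ring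
  rw [e, h1, h2]
  nlinarith [Real.cos_sq_add_sin_sq φ]

/-! ## §2 The gradient normal form at a level point -/

section Level

variable {δ : (Fin 2 → ℝ) → ℝ} (hδ2 : ContDiff ℝ 2 δ) {u : ℝ → ℝ} (hu2 : ContDiff ℝ 2 u) {ν : ℝ}
  (hroot : ∀ θ, sqDispersion (u θ • dir θ) + δ (u θ • dir θ) = ν)
include hδ2 hu2 hroot

omit hδ2 hu2 hroot in
/-- Linearity of `ℓ_p` in `v`: `ℓ_p(v) = v₀·ℓ_p(e₀) + v₁·ℓ_p(e₁)`. [folklore] -/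
theorem slopeForm_linear (u : ℝ → ℝ) (φ : ℝ) (v : Fin 2 → ℝ) :
    2 * Real.sin (XE u φ) * v 0 + 2 * Real.sin (YE u φ) * v 1 + fderiv ℝ δ (u φ • dir φ) v =
      v 0 * (2 * Real.sin (XE u φ) + fderiv ℝ δ (u φ • dir φ) ![1, 0]) +
        v 1 * (2 * Real.sin (YE u φ) + fderiv ℝ δ (u φ • dir φ) ![0, 1]) := by
  have hv : v = v 0 • (![1, 0] : Fin 2 → ℝ) + v 1 • (![0, 1] : Fin 2 → ℝ) := by
    ext i; fin_cases i <;> simp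
  conv_lhs => rw [hv]
  rw [map_add, map_smul, map_smul, smul_eq_mul, smul_eq_mul]
  have h0 : (v 0 • (![1, 0] : Fin 2 → ℝ) + v 1 • (![0, 1] : Fin 2 → ℝ)) 0 = v 0 := by simp
  have h1 : (v 0 • (![1, 0] : Fin 2 → ℝ) + v 1 • (![0, 1] : Fin 2 → ℝ)) 1 = v 1 := by simp
  rw [h0, h1]
  ring

/-- **Gradient normal form**: at a point of the level curve, for every `v`,
`ℓ_p(v) = (ρ_r·√S/u)·(cos α·v₀ + sin α·v₁)` — the coordinate gradient of `E = ε₀ + δ` is `(ρ_r√S/u)·dir α`, `α` the normal angle.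
[cite: BenfattoGiulianiMastropietro2003, §7.1 (A1.9)] -/
theorem slopeForm_eq_radial_mul (hpos : ∀ θ, 0 < u θ) (φ : ℝ) (v : Fin 2 → ℝ) :
    2 * Real.sin (XE u φ) * v 0 + 2 * Real.sin (YE u φ) * v 1 + fderiv ℝ δ (u φ • dir φ) v =
      (rayDispersionDt φ (u φ) + fderiv ℝ δ (u φ • dir φ) (dir φ)) * Real.sqrt (u φ ^ 2 + deriv u φ ^ 2) / u φ *
        (Real.cos (φ - Real.arctan (deriv u φ / u φ)) * v 0 + Real.sin (φ - Real.arctan (deriv u φ / u φ)) * v 1) := by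
  set g0 := 2 * Real.sin (XE u φ) + fderiv ℝ δ (u φ • dir φ) ![1, 0] with hg0
  set g1 := 2 * Real.sin (YE u φ) + fderiv ℝ δ (u φ • dir φ) ![0, 1] with hg1
  set α := φ - Real.arctan (deriv u φ / u φ) with hα
  set s := Real.sqrt (u φ ^ 2 + deriv u φ ^ 2) with hs
  have hu := hpos φ
  have hs0 : 0 < s := Real.sqrt_pos.2 (by positivity)
  -- tangency: `ℓ_p(p′) = 0`
  have htan : g0 * VXE u φ + g1 * VYE u φ = 0 := by
    have h := levelIdentity_one hδ2 hu2 hroot φ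
    have h' := slopeForm_linear (δ := δ) u φ ![VXE u φ, VYE u φ]
    have e0 : (![VXE u φ, VYE u φ] : Fin 2 → ℝ) 0 = VXE u φ := by simp
    have e1 : (![VXE u φ, VYE u φ] : Fin 2 → ℝ) 1 = VYE u φ := by simp
    rw [e0, e1, ← hg0, ← hg1] at h'
    linarith
  -- radial value: `ℓ_p(dir φ) = ρ_r`
  have hrad : g0 * Real.cos φ + g1 * Real.sin φ = rayDispersionDt φ (u φ) + fderiv ℝ δ (u φ • dir φ) (dir φ) := by
    have h := slopeForm_linear (δ := δ) u φ (dir φ)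
    rw [dir_zero, dir_one] at h
    rw [← two_mul_sin_dir_eq_rayDispersionDt]
    linarith
  -- tangent in terms of `α`
  have hX : VXE u φ = -(s * Real.sin α) := VXE_eq_neg_sqrt_mul_sin hu
  have hY : VYE u φ = s * Real.cos α := VYE_eq_sqrt_mul_cos hu
  rw [hX, hY] at htan
  -- `g ⊥ (−sin α, cos α)` ⇒ `g = Λ·(cos α, sin α)` with `Λ = g₀ cos α + g₁ sin α`
  have hperp : -g0 * Real.sin α + g1 * Real.cos α = 0 := by
    have : s * (-g0 * Real.sin α + g1 * Real.cos α) = 0 := by linarith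
    rcases mul_eq_zero.1 this with h | h
    · exact absurd h hs0.ne'
    · exact h
  have hcs := Real.cos_sq_add_sin_sq α
  have hg0' : g0 = (g0 * Real.cos α + g1 * Real.sin α) * Real.cos α := by
    linear_combination (-Real.sin α) * hperp - g0 * hcs
  have hg1' : g1 = (g0 * Real.cos α + g1 * Real.sin α) * Real.sin α := by
    linear_combination Real.cos α * hperp - g1 * hcs
  -- `Λ·(u/√S) = ρ_r`
  have hcosψ : s * (Real.cos α * Real.cos φ + Real.sin α * Real.sin φ) = u φ := sqrt_mul_cos_normalAngle_sub hu
  have hΛ : g0 * Real.cos α + g1 * Real.sin α =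
      (rayDispersionDt φ (u φ) + fderiv ℝ δ (u φ • dir φ) (dir φ)) * s / u φ := by
    have e : g0 * Real.cos φ + g1 * Real.sin φ =
        (g0 * Real.cos α + g1 * Real.sin α) * (Real.cos α * Real.cos φ + Real.sin α * Real.sin φ) := by
      linear_combination (-(Real.sin α * Real.cos φ - Real.cos α * Real.sin φ)) * hperp - (g0 * Real.cos φ + g1 * Real.sin φ) * hcs
    rw [eq_div_iff hu.ne']
    calc (g0 * Real.cos α + g1 * Real.sin α) * u φ
        = (g0 * Real.cos α + g1 * Real.sin α) * (s * (Real.cos α * Real.cos φ + Real.sin α * Real.sin φ)) := by rw [hcosψ]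
      _ = s * ((g0 * Real.cos α + g1 * Real.sin α) * (Real.cos α * Real.cos φ + Real.sin α * Real.sin φ)) := by ring
      _ = s * (g0 * Real.cos φ + g1 * Real.sin φ) := by rw [← e]
      _ = (rayDispersionDt φ (u φ) + fderiv ℝ δ (u φ • dir φ) (dir φ)) * s := by rw [hrad]; ring
  have hG0 : g0 = (rayDispersionDt φ (u φ) + fderiv ℝ δ (u φ • dir φ) (dir φ)) * s / u φ * Real.cos α :=
    calc g0 = (g0 * Real.cos α + g1 * Real.sin α) * Real.cos α := hg0'
      _ = _ := by rw [hΛ]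
  have hG1 : g1 = (rayDispersionDt φ (u φ) + fderiv ℝ δ (u φ • dir φ) (dir φ)) * s / u φ * Real.sin α :=
    calc g1 = (g0 * Real.cos α + g1 * Real.sin α) * Real.sin α := hg1'
      _ = _ := by rw [hΛ]
  rw [slopeForm_linear, ← hg0, ← hg1, hG0, hG1]
  ring

/-! ## §3 The slope of a second curve's tangent against the gradient: `sin` of the normal-angle difference -/

/-- **Slope–normal-angle identity**: for a second radius function `u₂` (positive) the crossing slope of its tangent at `θ` against the gradient at
`p₁(φ) = u(φ)·dir φ` is `ℓ_{p₁(φ)}(v₂(θ)) = (ρ_r(φ)·√S₁/u₁)·√S₂·sin(α₁(φ) − α₂(θ))`. [cite: BenfattoGiulianiMastropietro2003, §7.1 (A1.9)] -/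
theorem slopeForm_tangent_eq_sin (hpos : ∀ θ, 0 < u θ) {u₂ : ℝ → ℝ} (φ θ : ℝ) (hpos₂ : 0 < u₂ θ) :
    2 * Real.sin (XE u φ) * VXE u₂ θ + 2 * Real.sin (YE u φ) * VYE u₂ θ + fderiv ℝ δ (u φ • dir φ) ![VXE u₂ θ, VYE u₂ θ] =
      (rayDispersionDt φ (u φ) + fderiv ℝ δ (u φ • dir φ) (dir φ)) * Real.sqrt (u φ ^ 2 + deriv u φ ^ 2) / u φ *
        Real.sqrt (u₂ θ ^ 2 + deriv u₂ θ ^ 2) *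
          Real.sin ((φ - Real.arctan (deriv u φ / u φ)) - (θ - Real.arctan (deriv u₂ θ / u₂ θ))) := by
  have h := slopeForm_eq_radial_mul hδ2 hu2 hroot hpos φ ![VXE u₂ θ, VYE u₂ θ]
  have e0 : (![VXE u₂ θ, VYE u₂ θ] : Fin 2 → ℝ) 0 = VXE u₂ θ := by simp
  have e1 : (![VXE u₂ θ, VYE u₂ θ] : Fin 2 → ℝ) 1 = VYE u₂ θ := by simp
  rw [e0, e1] at h
  rw [h, VXE_eq_neg_sqrt_mul_sin hpos₂, VYE_eq_sqrt_mul_cos hpos₂,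
    Real.sin_sub (φ - Real.arctan (deriv u φ / u φ)) (θ - Real.arctan (deriv u₂ θ / u₂ θ))]
  ring

end Level

section Root

variable {a b : ℝ} (B : BandBounds a b) {δ : (Fin 2 → ℝ) → ℝ} (hδs : ContDiff ℝ 2 δ)
  {κ₀ κ₁ ν : ℝ} (hδ : ∀ k : Fin 2 → ℝ, (∀ i, |k i| ≤ π) → |δ k| ≤ κ₀) (hlo : a ≤ ν - κ₀) (hhi : ν + κ₀ ≤ b)
  (hκ : ∀ k : Fin 2 → ℝ, (∀ i, |k i| ≤ π) → ‖fderiv ℝ δ k‖ ≤ κ₁) (hκ₁ : κ₁ < B.Dtmin)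
  {u : ℝ → ℝ} (hu : ∀ θ, IsBandFermiRadius (ν - δ (u θ • dir θ)) θ (u θ))
include B hδs hδ hlo hhi hκ hκ₁ hu

/-- **Small slope forces parallel normals**: for a root selection `u` of `{ε₀ + δ = ν}` and ANY second radius function `u₂` with `u₂(θ) ≥ u_min`,
`(Dt_min − κ₁)·u_min·|sin(α₁(φ) − α₂(θ))| ≤ |ℓ_{p₁(φ)}(v₂(θ))|` (`ρ_r ≥ Dt_min − κ₁`, `√S₁ ≥ u₁`, `√S₂ ≥ u₂ ≥ u_min`).
[cite: BenfattoGiulianiMastropietro2003, §7.1 Lemma 7.1 (A1.9)] -/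
theorem abs_slopeForm_tangent_ge {u₂ : ℝ → ℝ} (φ θ : ℝ) (hu₂ : B.umin ≤ u₂ θ) :
    (B.Dtmin - κ₁) * B.umin * |Real.sin ((φ - Real.arctan (deriv u φ / u φ)) - (θ - Real.arctan (deriv u₂ θ / u₂ θ)))| ≤
      |2 * Real.sin (XE u φ) * VXE u₂ θ + 2 * Real.sin (YE u φ) * VYE u₂ θ + fderiv ℝ δ (u φ • dir φ) ![VXE u₂ θ, VYE u₂ θ]| := by
  have h2ne : (2 : WithTop ℕ∞) ≠ 0 := by norm_num
  have hu2 : ContDiff ℝ 2 u := contDiff_of_isRoot B hδs h2ne hδ hlo hhi hκ hκ₁ hu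
  have hroot : ∀ ϑ, sqDispersion (u ϑ • dir ϑ) + δ (u ϑ • dir ϑ) = ν := fun ϑ =>
    ((isBandFermiRadius_shifted_iff δ ν ϑ (u ϑ)).1 (hu ϑ)).2
  have hpos : ∀ ϑ, 0 < u ϑ := fun ϑ => (mem_Ioo_of_shifted B hδ hlo hhi (hu ϑ)).1
  have hum0 := B.umin_pos
  have hpos₂ : 0 < u₂ θ := hum0.trans_le hu₂
  rw [slopeForm_tangent_eq_sin hδs hu2 hroot hpos φ θ hpos₂]
  set ρr := rayDispersionDt φ (u φ) + fderiv ℝ δ (u φ • dir φ) (dir φ) with hρr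
  set s₁ := Real.sqrt (u φ ^ 2 + deriv u φ ^ 2) with hs₁
  set s₂ := Real.sqrt (u₂ θ ^ 2 + deriv u₂ θ ^ 2) with hs₂
  set σ := Real.sin ((φ - Real.arctan (deriv u φ / u φ)) - (θ - Real.arctan (deriv u₂ θ / u₂ θ))) with hσ
  have hρ : B.Dtmin - κ₁ ≤ ρr := Dtmin_sub_le_pertDt B hδ hlo hhi hκ hu φ
  have hρ0 : 0 < B.Dtmin - κ₁ := sub_pos.2 hκ₁
  have hu₁ := hpos φ
  -- `√S₁ ≥ u₁`, `√S₂ ≥ u₂ ≥ u_min`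
  have hs₁u : u φ ≤ s₁ := by
    rw [hs₁]
    calc u φ = Real.sqrt (u φ ^ 2) := (Real.sqrt_sq hu₁.le).symm
      _ ≤ Real.sqrt (u φ ^ 2 + deriv u φ ^ 2) := Real.sqrt_le_sqrt (by nlinarith [sq_nonneg (deriv u φ)])
  have hs₂u : u₂ θ ≤ s₂ := by
    rw [hs₂]
    calc u₂ θ = Real.sqrt (u₂ θ ^ 2) := (Real.sqrt_sq hpos₂.le).symm
      _ ≤ Real.sqrt (u₂ θ ^ 2 + deriv u₂ θ ^ 2) := Real.sqrt_le_sqrt (by nlinarith [sq_nonneg (deriv u₂ θ)])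
  have hρpos : 0 < ρr := hρ0.trans_le hρ
  have hdiv : 1 ≤ s₁ / u φ := by rw [le_div_iff₀ hu₁, one_mul]; exact hs₁u
  have hs₂0 : 0 ≤ s₂ := hpos₂.le.trans hs₂u
  have hcoef0 : 0 ≤ ρr * s₁ / u φ * s₂ := by
    have : 0 ≤ s₁ := hu₁.le.trans hs₁u
    positivity
  have hcoef : (B.Dtmin - κ₁) * B.umin ≤ ρr * s₁ / u φ * s₂ := by
    calc (B.Dtmin - κ₁) * B.umin ≤ ρr * s₂ := mul_le_mul hρ (hu₂.trans hs₂u) hum0.le hρpos.le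
      _ = ρr * 1 * s₂ := by ring
      _ ≤ ρr * (s₁ / u φ) * s₂ := mul_le_mul_of_nonneg_right (mul_le_mul_of_nonneg_left hdiv hρpos.le) hs₂0
      _ = ρr * s₁ / u φ * s₂ := by ring
  rw [abs_mul, abs_of_nonneg hcoef0]
  exact mul_le_mul_of_nonneg_right hcoef (abs_nonneg σ)

end Root

end Summit.HubbardSuperconductivity.HubbardSuperconductivity.Theorems.PerturbedFermiCurve

end
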